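import Summits.HodgeConjecture.HodgeConjecture.Theorems.PadicSemiregularLiftHodgeFermatVarietiesFiveQUnits
import HarnessLib

/-!
# Hodge `(p+1)`-tuples of level `pq`, I: the odd part of the unit multiplicities — line `cancel-by-any-claim-lattice`, crux `HodgeFermatVarieties` (stmt-HodgeConjecture-1334)

First file of lead c3's LEVEL-`pq` programme (primes `5 ≤ p < q`, `q ≠ p + 2`), the generalisation of the
level-`5q` classification (`FiveQ.classification`) from `p = 5` to an arbitrary prime `p ≥ 5`: EVERY HODGE
MULTISET OF `p + 1` ELEMENTS OF `ℤ/pq` IS `(p+1)/2` PAIRS OR AOKI'S STANDARD ELEMENT `σ_{p,a}` (`a` a unit), hence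
reachable from the printed supply at its own level, which gives the Hodge conjecture for the Fermat
`(p-1)`-folds `X^{p-1}_{pq}` modulo the named facts — the first dimension in which Aoki's Thm A
(`𝔅ⁿₘ = 𝔇ⁿₘ` iff every prime of `m` exceeds `n + 2`) does not apply to the degree `pq`.

This file: the unit entries. Write `c(x)` for the multiplicity of `x` in `s` and `o(x) = c(x) - c(-x)`.
* `units_oddPart_split`: `o(x) = G(x mod q) + H(x mod p)` on units, `G`, `H` odd — Aoki's criterion at the
  top conductor `pq` (`FiveQ.stub_sum_inv_char_eq_zero_of_isHodgeMultiset`) fed into the Fourier split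
  (`FiveQ.stub_oddPart_split_of_orthogonal`);
* `fibre_sum_count`: `n(b) - n(-b) = (p - 1) G(b)` for the fibre sums `n(b) = Σ_{x ≡ b (q)} c(x)`;
* `two_le_card_units`: for `H` odd, `H ≢ 0`, and any `g`, at least two of the `p - 1` numbers `g + H(a)` are
  non-zero (`p ≥ 5`): the level set `{a : H(a) = -g}` is disjoint from its negative when `g ≠ 0`;
* `card_support_ge` / `card_support_le`: `2(q-1) ≤ #supp(o) ≤ 2 · #(unit entries)` when `H ≢ 0`.

References: [Aoki1983] N. Aoki, Math. Ann. 266 (1983) §2 Prop. 2.2 (criterion), Thm A / A′ (§7);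
[Aoki1987] N. Aoki, J. Math. Soc. Japan 39 (1987) §1 (standard elements).
-/

set_option linter.dupNamespace false

noncomputable section

open Finset
open Literature.AlgebraicGeometry.HodgeTheory Literature.AlgebraicGeometry.HodgeTheory.FermatCharacter
open Summit.HodgeConjecture.HodgeConjecture.Theorems.CancelByAnyClaimLattice.FiveQ

namespace Summit.HodgeConjecture.HodgeConjecture.Theorems.CancelByAnyClaimLattice.PQ

section LevelPQ

variable {p q : ℕ} [Fact p.Prime] [Fact q.Prime]

/-- **`o = G + H`**: for a Hodge multiset `s` of level `pq` (`p ≠ q` primes) there are odd functions `G` on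
`(ℤ/q)ˣ` and `H` on `(ℤ/p)ˣ` with `c(x) - c(-x) = G(x mod q) + H(x mod p)` for every unit `x` ((I) + (†)).
[cite: Aoki1983, Prop. 2.2] -/
theorem units_oddPart_split_pq : ∀ {p q : ℕ} [Fact p.Prime] [Fact q.Prime], p ≠ q → ∀ {s : Multiset (ZMod (p * q))}, IsHodgeMultiset s →
    ∃ (G : (ZMod q)ˣ → ℂ) (H : (ZMod p)ˣ → ℂ),
      (∀ b, G (-b) = -G b) ∧ (∀ a, H (-a) = -H a) ∧
      ∀ x : (ZMod (p * q))ˣ, (Multiset.count (x : ZMod (p * q)) s : ℂ) - Multiset.count (-(x : ZMod (p * q))) s =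
        G (ZMod.unitsMap (dvd_mul_left q p) x) + H (ZMod.unitsMap (dvd_mul_right p q) x) := by
  intro p q _ _ hpq s hs
  classical
  refine stub_oddPart_split_of_orthogonal p q (coprime_of_ne hpq) (fun x ↦ (Multiset.count x s : ℂ)) ?_
  intro χ₁ χ₂ h₁ h₂ hodd
  set χ := DirichletCharacter.changeLevel (dvd_mul_right p q) χ₁ *
    DirichletCharacter.changeLevel (dvd_mul_left q p) χ₂ with hχdef
  -- apply (I) to the odd primitive character `χ⁻¹`
  have hinv : χ⁻¹ = DirichletCharacter.changeLevel (dvd_mul_right p q) χ₁⁻¹ *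
      DirichletCharacter.changeLevel (dvd_mul_left q p) χ₂⁻¹ := by
    rw [hχdef, mul_inv, map_inv, map_inv]
  have hprim : (χ⁻¹).IsPrimitive := by
    rw [hinv]
    exact prodChar_isPrimitive (coprime_of_ne hpq) (isPrimitive_of_ne_one (inv_ne_one.mpr h₁))
      (isPrimitive_of_ne_one (inv_ne_one.mpr h₂))
  have hoddinv : (χ⁻¹).Odd := inv_neg_one_of_odd hodd
  have key := stub_sum_inv_char_eq_zero_of_isHodgeMultiset (p * q) s hs χ⁻¹ hoddinv hprim
  rw [multiset_sum_eq_sum_count] at key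
  simpa only [inv_inv_apply] using key

/-! ### §4 Fibre sums of the multiplicities -/

/-- **Fibre sums of `o`**: with `n(b) = Σ_{x ≡ b (q), x unit} c(x)`,
`n(b) - n(-b) = (p - 1) G(b)` (sum `o = G + H` over the fibre of `b`; `Σ H = 0`). [folklore] -/
theorem fibre_sum_count (hpq : p ≠ q) {s : Multiset (ZMod (p * q))} {G : (ZMod q)ˣ → ℂ} {H : (ZMod p)ˣ → ℂ}
    (hH : ∀ a, H (-a) = -H a)
    (ho : ∀ x : (ZMod (p * q))ˣ, (Multiset.count (x : ZMod (p * q)) s : ℂ) - Multiset.count (-(x : ZMod (p * q))) s =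
      G (ZMod.unitsMap (dvd_mul_left q p) x) + H (ZMod.unitsMap (dvd_mul_right p q) x))
    (b : (ZMod q)ˣ) :
    (∑ x ∈ univ.filter (fun x : (ZMod (p * q))ˣ ↦ ZMod.unitsMap (dvd_mul_left q p) x = b),
        (Multiset.count (x : ZMod (p * q)) s : ℂ)) -
      ∑ x ∈ univ.filter (fun x : (ZMod (p * q))ˣ ↦ ZMod.unitsMap (dvd_mul_left q p) x = -b),
        (Multiset.count (x : ZMod (p * q)) s : ℂ) = (p - 1 : ℕ) * G b := by
  classical
  -- the second sum, reindexed by `x ↦ -x`, is the sum of `c(-x)` over the fibre of `b`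
  have hneg : ∑ x ∈ univ.filter (fun x : (ZMod (p * q))ˣ ↦ ZMod.unitsMap (dvd_mul_left q p) x = -b),
      (Multiset.count (x : ZMod (p * q)) s : ℂ) =
      ∑ x ∈ univ.filter (fun x : (ZMod (p * q))ˣ ↦ ZMod.unitsMap (dvd_mul_left q p) x = b),
        (Multiset.count (-(x : ZMod (p * q))) s : ℂ) := by
    refine Finset.sum_nbij' (fun x ↦ -x) (fun x ↦ -x) (fun x hx ↦ ?_) (fun x hx ↦ ?_) (fun x _ ↦ neg_neg x)
      (fun x _ ↦ neg_neg x) (fun x _ ↦ by rw [Units.val_neg, neg_neg])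
    · simp only [mem_filter, mem_univ, true_and] at hx ⊢
      rw [unitsMap_neg, hx, neg_neg]
    · simp only [mem_filter, mem_univ, true_and] at hx ⊢
      rw [unitsMap_neg, hx]
  rw [hneg, ← Finset.sum_sub_distrib]
  have h1 : ∑ x ∈ univ.filter (fun x : (ZMod (p * q))ˣ ↦ ZMod.unitsMap (dvd_mul_left q p) x = b),
      ((Multiset.count (x : ZMod (p * q)) s : ℂ) - Multiset.count (-(x : ZMod (p * q))) s) =
      ∑ x ∈ univ.filter (fun x : (ZMod (p * q))ˣ ↦ ZMod.unitsMap (dvd_mul_left q p) x = b),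
        (G b + H (ZMod.unitsMap (dvd_mul_right p q) x)) := by
    refine Finset.sum_congr rfl fun x hx ↦ ?_
    simp only [mem_filter, mem_univ, true_and] at hx
    rw [ho x, hx]
  rw [h1, Finset.sum_add_distrib, Finset.sum_const, card_fibre hpq b, sum_fibre_eq_sum_units hpq b H,
    sum_units_eq_zero_of_odd hH, add_zero, nsmul_eq_mul]

/-! ### §5 Counting: the support of `o` -/

/-- `b ≠ -b` for a unit `b` of `ℤ/q`, `q` an odd prime. [folklore] -/
theorem units_ne_neg (hq2 : q ≠ 2) (b : (ZMod q)ˣ) : b ≠ -b := by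
  intro hb
  have h2 : (2 : ZMod q) * (b : ZMod q) = 0 := by
    have := congrArg (fun u : (ZMod q)ˣ ↦ (u : ZMod q)) hb
    simp only [Units.val_neg] at this
    linear_combination this
  rcases mul_eq_zero.mp h2 with h | h
  · have hq2' : (q : ℕ) ∣ 2 := by
      have : ((2 : ℕ) : ZMod q) = 0 := by exact_mod_cast h
      exact (ZMod.natCast_eq_zero_iff 2 q).mp this
    have hpr : q.Prime := Fact.out
    exact hq2 ((Nat.prime_dvd_prime_iff_eq hpr Nat.prime_two).mp hq2')
  · exact (Units.ne_zero b) h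

/-- **At least two points per fibre when `H ≢ 0`** (`p ≥ 5`): for `H` odd on `(ℤ/p)ˣ`, not identically zero,
and any `g`, at least two of the `p - 1` numbers `g + H(a)` are non-zero. If `g = 0` the support of `H`
contains some `a₀` and `-a₀`; if `g ≠ 0` the level set `Z = {a : H(a) = -g}` is disjoint from `-Z` (there
`H = g ≠ -g`), so `#Z ≤ #Zᶜ` and `2 #Zᶜ ≥ p - 1 ≥ 4`. [folklore] -/
theorem two_le_card_units (hp : 5 ≤ p) {H : (ZMod p)ˣ → ℂ} (hH : ∀ a, H (-a) = -H a) (hH0 : ∃ a, H a ≠ 0)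
    (g : ℂ) : 2 ≤ #(univ.filter fun a : (ZMod p)ˣ ↦ g + H a ≠ 0) := by
  classical
  have hp2 : p ≠ 2 := by omega
  by_cases hg : g = 0
  · subst hg
    obtain ⟨a₀, ha₀⟩ := hH0
    have hne : a₀ ≠ -a₀ := units_ne_neg hp2 a₀
    calc 2 = #({a₀, -a₀} : Finset (ZMod p)ˣ) := by rw [card_pair hne]
      _ ≤ _ := by
        refine card_le_card fun x hx ↦ ?_
        simp only [mem_insert, mem_singleton] at hx
        simp only [mem_filter, mem_univ, true_and, zero_add]
        rcases hx with rfl | rfl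
        · exact ha₀
        · rw [hH]; exact neg_ne_zero.mpr ha₀
  · -- `Z = {a : g + H a = 0}` injects into its complement under negation
    set Z : Finset (ZMod p)ˣ := univ.filter fun a ↦ g + H a = 0 with hZ
    have hcompl : univ.filter (fun a : (ZMod p)ˣ ↦ g + H a ≠ 0) = Zᶜ := by
      ext a; simp [hZ]
    have hmap : Z.image (fun a ↦ -a) ⊆ Zᶜ := by
      intro x hx
      simp only [mem_image] at hx
      obtain ⟨a, ha, rfl⟩ := hx
      simp only [hZ, mem_compl, mem_filter, mem_univ, true_and] at ha ⊢
      rw [hH]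
      intro h
      apply hg
      linear_combination (ha + h) / 2
    have hZle : #Z ≤ #Zᶜ := by
      calc #Z = #(Z.image fun a ↦ -a) := (card_image_of_injective _ neg_injective).symm
        _ ≤ #Zᶜ := card_le_card hmap
    have htot : #Z + #Zᶜ = p - 1 := by
      rw [Finset.card_add_card_compl, ZMod.card_units p]
    rw [hcompl]
    omega

/-- **The support of `o` has at least `2(q-1)` points when `H ≢ 0`.** [folklore] -/
theorem card_support_ge (hp : 5 ≤ p) (hpq : p ≠ q) {G : (ZMod q)ˣ → ℂ} {H : (ZMod p)ˣ → ℂ}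
    (hH : ∀ a, H (-a) = -H a) (hH0 : ∃ a, H a ≠ 0) :
    2 * (q - 1) ≤ #(univ.filter fun x : (ZMod (p * q))ˣ ↦
      G (ZMod.unitsMap (dvd_mul_left q p) x) + H (ZMod.unitsMap (dvd_mul_right p q) x) ≠ 0) := by
  classical
  rw [card_eq_sum_card_fibre]
  have hb : ∀ b : (ZMod q)ˣ, 2 ≤ #((univ.filter fun x : (ZMod (p * q))ˣ ↦
      G (ZMod.unitsMap (dvd_mul_left q p) x) + H (ZMod.unitsMap (dvd_mul_right p q) x) ≠ 0).filter
        fun x ↦ ZMod.unitsMap (dvd_mul_left q p) x = b) := by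
    intro b
    have h := card_fibre_filter hpq b (fun a : (ZMod p)ˣ ↦ G b + H a ≠ 0)
    rw [show ((univ.filter fun x : (ZMod (p * q))ˣ ↦
        G (ZMod.unitsMap (dvd_mul_left q p) x) + H (ZMod.unitsMap (dvd_mul_right p q) x) ≠ 0).filter
          fun x ↦ ZMod.unitsMap (dvd_mul_left q p) x = b) =
        univ.filter fun x : (ZMod (p * q))ˣ ↦ ZMod.unitsMap (dvd_mul_left q p) x = b ∧
          G b + H (ZMod.unitsMap (dvd_mul_right p q) x) ≠ 0 by
      ext x
      simp only [mem_filter, mem_univ, true_and]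
      constructor
      · rintro ⟨h1, h2⟩; exact ⟨h2, by rw [← h2]; exact h1⟩
      · rintro ⟨h1, h2⟩; exact ⟨by rw [h1]; exact h2, h1⟩, h]
    exact two_le_card_units hp hH hH0 (G b)
  calc 2 * (q - 1) = ∑ _b : (ZMod q)ˣ, 2 := by
        rw [Finset.sum_const, Finset.card_univ, ZMod.card_units q, smul_eq_mul, mul_comm]
    _ ≤ _ := Finset.sum_le_sum fun b _ ↦ hb b

/-- **The support of `o` is contained in the unit entries and their negatives**, hence has at most
`2 · (number of unit entries)` points. [folklore] -/
theorem card_support_le {s : Multiset (ZMod (p * q))} {G : (ZMod q)ˣ → ℂ} {H : (ZMod p)ˣ → ℂ}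
    (ho : ∀ x : (ZMod (p * q))ˣ, (Multiset.count (x : ZMod (p * q)) s : ℂ) - Multiset.count (-(x : ZMod (p * q))) s =
      G (ZMod.unitsMap (dvd_mul_left q p) x) + H (ZMod.unitsMap (dvd_mul_right p q) x)) :
    #(univ.filter fun x : (ZMod (p * q))ˣ ↦
        G (ZMod.unitsMap (dvd_mul_left q p) x) + H (ZMod.unitsMap (dvd_mul_right p q) x) ≠ 0) ≤
      2 * Multiset.card (s.filter IsUnit) := by
  classical
  -- the support is contained in `T ∪ (-T)`, `T` = the units occurring in `s`
  set T : Finset (ZMod (p * q))ˣ := univ.filter fun x ↦ (x : ZMod (p * q)) ∈ s with hT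
  have hsub : (univ.filter fun x : (ZMod (p * q))ˣ ↦
      G (ZMod.unitsMap (dvd_mul_left q p) x) + H (ZMod.unitsMap (dvd_mul_right p q) x) ≠ 0) ⊆
      T ∪ T.image (fun x ↦ -x) := by
    intro x hx
    simp only [mem_filter, mem_univ, true_and] at hx
    rw [← ho x] at hx
    simp only [hT, mem_union, mem_filter, mem_univ, true_and, mem_image]
    by_contra hc
    push Not at hc
    have h1 : Multiset.count (x : ZMod (p * q)) s = 0 := Multiset.count_eq_zero.mpr hc.1
    have h2 : Multiset.count (-(x : ZMod (p * q))) s = 0 := by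
      refine Multiset.count_eq_zero.mpr fun hmem ↦ ?_
      exact hc.2 (-x) (by simpa using hmem) (neg_neg x)
    rw [h1, h2] at hx
    norm_num at hx
  -- `#T ≤ #(unit entries)`
  have hT_le : #T ≤ Multiset.card (s.filter IsUnit) := by
    have hinj : (T.image fun x : (ZMod (p * q))ˣ ↦ (x : ZMod (p * q))).card = #T :=
      Finset.card_image_of_injective _ Units.val_injective
    rw [← hinj]
    calc #(T.image fun x : (ZMod (p * q))ˣ ↦ (x : ZMod (p * q)))
        ≤ #((s.filter IsUnit).toFinset) := by
          refine card_le_card fun y hy ↦ ?_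
          simp only [mem_image, hT, mem_filter, mem_univ, true_and] at hy
          obtain ⟨x, hx, rfl⟩ := hy
          rw [Multiset.mem_toFinset, Multiset.mem_filter]
          exact ⟨hx, Units.isUnit x⟩
      _ ≤ Multiset.card (s.filter IsUnit) := Multiset.toFinset_card_le _
  calc #(univ.filter fun x : (ZMod (p * q))ˣ ↦
        G (ZMod.unitsMap (dvd_mul_left q p) x) + H (ZMod.unitsMap (dvd_mul_right p q) x) ≠ 0)
      ≤ #(T ∪ T.image (fun x ↦ -x)) := card_le_card hsub
    _ ≤ #T + #(T.image fun x ↦ -x) := card_union_le _ _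
    _ ≤ #T + #T := by
        have : #(T.image fun x : (ZMod (p * q))ˣ ↦ -x) ≤ #T := card_image_le
        omega
    _ ≤ 2 * Multiset.card (s.filter IsUnit) := by omega

end LevelPQ

end Summit.HodgeConjecture.HodgeConjecture.Theorems.CancelByAnyClaimLattice.PQ
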